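import Summits.QuantumFields.BalabanUV.T4Continuum.Support.NE7CurvedExactLift
import Summits.QuantumFields.BalabanUV.T4Continuum.Support.NE3TangentCovariantStructure
import HarnessLib

/-!
# NE7HierarchicalStep — ONE LEVEL OF THE HIERARCHICAL REPRESENTATIVE (route (H′), step (K)): given the level-`i` field `X` with `cpush 2 W X = X⁺` and the level-`(i+1)` representative
# `X⁺ + gaugeDir W̄ ν⁺` (`W̄ = cavg 2 W`, `ν⁺` skew periodic), there are a skew periodic gauge `ν` on level `i` with **`ν (2•y) = ν⁺ y`** (sampling consistency) and a slice element
# `J ∈ frameFreeBlockLandauW 2 Q 1 W` with **`X + gaugeDir W ν = curvedLift (X⁺ + gaugeDir W̄ ν⁺) + J`** and `cpush 2 W J = 0` — the level-`i` representative is the EXACT CURVED LIFT of the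
# level-`(i+1)` representative plus a one-level slice fluctuation, and it is again «original tower + a gauge direction whose potential samples to the previous one»
# (lineage `b2b-balaban-t4-ne7b-p1`, gen 163; route (H′), memo `t4/b2b-balaban-t4-ne7b-p1/g162/records/SCOPING-LEVELMASSES.md` §3 (K)∕§8, `g163/records/SCOPING-R4.md` §5)

Cell `pub-balaban`, rung (B)+1 sub-cell t4, lineage `b2b-balaban-t4-ne7b-p1` (row NE7b OWNER + CRUX PROVER; junction service for row NE7 on ROAD-G116 §6 (G3) ∕ the ℓ² route to (G′)),
generation 163.
WHY.  The hierarchical representative `X′_i = r_{W_i} X′_{i+1} + J_i` of a fibre element must be the linearised tower of an HONEST fine field, gauge equivalent to the given one by a gauge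
vanishing on the top corners (so that ✓ p833166 `B[X + ξ_Y] = B[X]` applies and the multiplier term is evaluated on the representative).  The memo's depth-disjoint placement is replaced by
the simpler SAMPLING device: extend the upper potential piecewise-constantly (`λ(x) := ν⁺(blk 2 x)`), push the gauge direction forward EXACTLY (✓ `NE3TangentCovariantStructure.cpush_gaugeDir`),
apply row NE3's one-level slice step ✓ `NE7OneLevelSliceStep.exists_sliceStep` with the EXACT curved lift ✓ `NE7CurvedExactLift.cpush_curvedLift` as the reference lift, and add the corner-
trivial slice gauge.  Iterating from the top (`ν_{top} = 0`) gives potentials with `ν_i(2y) = ν_{i+1}(y)`, hence `ν_0(2^{m+1}z) = 0`.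
WHAT ([folklore]; 0 def, 0 sorry; `d = 4`, `L = 2`, one-level class background): `blkExt_periodic`, `blkExt_sample`, and the headline **`hierarchical_step`**.
WHAT IS NOT HERE: the iteration over the tower packaged as one statement (successor), the budget assembly (G3).
HONEST FRAMING (page 1): composition of kernel theorems about OUR objects; nothing of Bałaban's asserted; NOT (G3), NOT (G′), NOT NE7∕NE3 as spine nodes; row NE7b NOT PRINTED ∕ NOT PROVED;
spine 0∕9; finite T⁴ rung (B)+1 — NOT infinite volume, NOT mass gap, NOT BetaPertH, NOT Clay.
-/

set_option autoImplicit false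

open scoped BigOperators Matrix Matrix.Norms.L2Operator
open Finset

namespace Summit.QuantumFields.BalabanUV.T4Continuum.NE7HierarchicalStep

open Literature.MathematicalPhysics.QuantumFieldTheory.Balaban1983to89
open B7Prop1Explicit B7Prop2Explicit
open T4AveragingDeficitWall (IsUnitaryCfg IsSkewDir SmallField)
open T4AveragingDeficitWallBoundary (IsPeriodicCfg)
open AveragingDeficitNearIdentity (Ad_add)
open AveragingDeficitPeriodicCounting (IsPeriodicDir)
open AveragingDeficitTwoLevelPrep (prop1Radius)
open AveragingDeficitMultiLevelPrep (cpush tower LevelSmall)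
open AveragingDeficitChartCalculus (cavg)
open BlockAveragePushDirGauge (gaugeDir isPeriodicDir_gaugeDir)
open SpreadLift (loopRad)
open NE3QbarIterCovLiftPrep (cruxC)
open NE3TangentCovariantTower (step_small)
open NE3TangentCovariantStructure (cpush_add cpush_gaugeDir)
open NE3LandauOrbit (gaugeDir_skew)
open NE3FrameFreeSliceW (frameFreeBlockLandauW)
open SmoothRefineBlocks (blk blk_res_add_period blk_res_smul)
open NE7OneLevelSliceStep (exists_sliceStep)
open NE7CurvedExactLift (curvedLift cpush_curvedLift isSkewDir_curvedLift isPeriodicDir_curvedLift)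

noncomputable section

variable {n : Type*} [Fintype n] [DecidableEq n]

omit [Fintype n] [DecidableEq n] in
/-- The piecewise-constant extension `x ↦ ν⁺ (blk 2 x)` of a `Q`-periodic potential is `2Q`-periodic. [folklore] -/
theorem blkExt_periodic {Q : ℕ} {ν : Site 4 → Matrix n n ℂ} (hν : ∀ (y : Site 4) (j : Fin 4), ν (y + (Q : ℤ) • e j) = ν y) (x : Site 4) (j : Fin 4) :
    ν (blk 2 (x + ((2 * Q : ℕ) : ℤ) • e j)) = ν (blk 2 x) := by
  have h := (blk_res_add_period (d := 4) (L := 2) (by norm_num) x (Q : ℤ) j).1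
  rw [show (((2 * Q : ℕ) : ℤ)) = ((2 : ℕ) : ℤ) * (Q : ℤ) by push_cast; ring, h, hν]

omit [Fintype n] [DecidableEq n] in
/-- The extension samples back: `ν⁺ (blk 2 (2•y)) = ν⁺ y`. [folklore] -/
theorem blkExt_sample (ν : Site 4 → Matrix n n ℂ) (y : Site 4) : ν (blk 2 ((2 : ℤ) • y)) = ν y := by
  have h := (blk_res_smul (d := 4) (L := 2) (by norm_num) y).1
  rw [show (((2 : ℕ) : ℤ)) = (2 : ℤ) from rfl] at h
  rw [h]

/-- **ONE LEVEL OF THE HIERARCHICAL REPRESENTATIVE** (`d = 4`, `L = 2`; `W` a one-level class background of period `2Q`, bondwise radius not needed here).  Data: the level field `X` (skew,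
`2Q`-periodic), its push-forward `X⁺ = cpush 2 W X`, and an upper potential `ν⁺` (skew, `Q`-periodic).  Then there are a skew `2Q`-periodic potential `ν` with `ν (2•y) = ν⁺ y` and
`J ∈ frameFreeBlockLandauW 2 Q 1 W` with `cpush 2 W J = 0` and `X + gaugeDir W ν = curvedLift (X⁺ + gaugeDir (cavg 2 W) ν⁺) + J`. [folklore] -/
theorem hierarchical_step [Nonempty n] {W : Site 4 → Fin 4 → (Matrix n n ℂ)ˣ} {x : ℝ} (hWu : IsUnitaryCfg W) (hx : 0 ≤ x) (hs : LevelSmall 4 2 0 x)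
    (hWx : SmallField W x) (Q : ℕ) [NeZero Q] (hθ : cruxC 4 2 * ((((2 : ℕ) : ℝ) ^ (0 + 1)) ^ 2 * x) < 1)
    (hE : 4 * ((4 : ℕ) : ℝ) ^ 2 * (((2 : ℕ) : ℝ) ^ (0 + 1) - 1) ^ 2 * x + 16 * (4 : ℕ) * loopRad 4 2 ((prop1Radius 4 2)^[0] x) ≤ 1 / 2)
    (hWP : IsPeriodicCfg W ((tower 2 Q (0 + 1) : ℕ) : ℤ))
    {X : Site 4 → Fin 4 → Matrix n n ℂ} (hXs : IsSkewDir X) (hXP : IsPeriodicDir X ((tower 2 Q (0 + 1) : ℕ) : ℤ))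
    {νp : Site 4 → Matrix n n ℂ} (hνs : ∀ y, νp y ∈ skewAdjoint (Matrix n n ℂ)) (hνP : ∀ (y : Site 4) (j : Fin 4), νp (y + (Q : ℤ) • e j) = νp y)
    (hX's : IsSkewDir (fun y μ => cpush 2 W X y μ + gaugeDir (cavg 2 W) νp y μ)) :
    ∃ ν : Site 4 → Matrix n n ℂ, (∀ y, ν y ∈ skewAdjoint (Matrix n n ℂ)) ∧ (∀ (y : Site 4) (j : Fin 4), ν (y + ((tower 2 Q (0 + 1) : ℕ) : ℤ) • e j) = ν y)
      ∧ (∀ y : Site 4, ν ((2 : ℤ) • y) = νp y)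
      ∧ ∃ J : Site 4 → Fin 4 → Matrix n n ℂ, J ∈ frameFreeBlockLandauW (d := 4) (n := n) 2 Q 1 W ∧ cpush 2 W J = 0
        ∧ (fun y μ => X y μ + gaugeDir W ν y μ)
          = fun y μ => curvedLift (by norm_num) hWu hx hs hWx Q hθ hE hX's y μ + J y μ := by
  have hL1 : (1 : ℕ) ≤ 2 := by norm_num
  obtain ⟨h512, hWbu, hr0, hWbx⟩ := step_small (d := 4) hL1 hWu hx hs.two hWx
  have ht : (((tower 2 Q (0 + 1) : ℕ) : ℤ)) = (((2 * Q : ℕ) : ℤ)) := by simp [tower]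
  have hWP2 : IsPeriodicCfg W (((2 * Q : ℕ) : ℤ)) := by rw [← ht]; exact hWP
  -- the extended potential and the incoming field
  set lam : Site 4 → Matrix n n ℂ := fun x' => νp (blk 2 x') with hlam
  have hlams : ∀ x', lam x' ∈ skewAdjoint (Matrix n n ℂ) := fun x' => hνs _
  have hlamP : ∀ (x' : Site 4) (j : Fin 4), lam (x' + (((2 * Q : ℕ) : ℤ)) • e j) = lam x' := fun x' j => blkExt_periodic hνP x' j
  set Z : Site 4 → Fin 4 → Matrix n n ℂ := fun y μ => X y μ + gaugeDir W lam y μ with hZ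
  have hZs : IsSkewDir Z := fun y μ => (skewAdjoint _).add_mem (hXs y μ) (gaugeDir_skew hWu hlams y μ)
  have hZP : IsPeriodicDir Z (((tower 2 Q (0 + 1) : ℕ) : ℤ)) := by
    intro y i μ
    simp only [hZ, hXP y i μ]
    rw [ht, isPeriodicDir_gaugeDir hWP2 hlamP y i μ]
  -- its push-forward is the upper representative
  set w : Site 4 → Fin 4 → Matrix n n ℂ := fun y μ => cpush 2 W X y μ + gaugeDir (cavg 2 W) νp y μ with hw
  have hZw : cpush 2 W Z = w := by
    rw [hZ, cpush_add hL1 hWu hx h512 hWx X (gaugeDir W lam), cpush_gaugeDir (M := Q) hL1 hWu hWP2 hx h512 hWx hlams hlamP]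
    funext y μ
    simp only [hw, hlam, Nat.cast_ofNat, blkExt_sample]
  -- the exact curved lift of the upper representative
  have hwP : IsPeriodicDir w (Q : ℤ) := by
    have h := AveragingDeficitMultiLevelPrep.isPeriodicDir_cpush 2 Q (W := W) (by
      intro x' κ μ; have := hWP2 x' κ μ; rw [show (((2 * Q : ℕ) : ℤ)) = (2 : ℤ) * Q by push_cast; ring] at this; exact this) (φ := Z) (by
      intro x' κ μ; have := hZP x' κ μ; rw [ht, show (((2 * Q : ℕ) : ℤ)) = (2 : ℤ) * Q by push_cast; ring] at this; exact this)
    rw [hZw] at h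
    exact h
  have hR := cpush_curvedLift (d := 4) (by norm_num) hWu hx hs hWx Q hθ hE (by norm_num) hWP hX's hwP
  have hRs := isSkewDir_curvedLift (d := 4) (by norm_num : 2 ≤ 2) hWu hx hs hWx Q hθ hE hX's
  have hRP := isPeriodicDir_curvedLift (d := 4) (by norm_num) hWu hx hs hWx Q hθ hE hWP hX's hwP
  -- row NE3's one-level slice step
  obtain ⟨mu, hmus, hmuP, hmu0, J, hJ, hid, hJ0, -⟩ :=
    exists_sliceStep (d := 4) (L := 2) (M := Q) hL1 (by norm_num) hWu hWP hx hs hWx hZs hZP hRs hRP hZw hR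
  refine ⟨fun x' => lam x' + mu x', fun x' => (skewAdjoint _).add_mem (hlams x') (hmus x'), fun y j => ?_, fun y => ?_, J, hJ, hJ0, ?_⟩
  · have h2 := hmuP y j
    rw [ht] at h2
    show lam _ + mu _ = lam y + mu y
    rw [ht, hlamP y j, h2]
  · have h0 := hmu0 y
    simp only [Nat.cast_ofNat] at h0
    show lam _ + mu _ = νp y
    rw [h0, add_zero, hlam]
    exact blkExt_sample νp y
  · rw [← hid]
    funext y μ
    simp only [hZ, gaugeDir, Ad_add]
    abel

end

end Summit.QuantumFields.BalabanUV.T4Continuum.NE7HierarchicalStep
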